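import Summits.QuantumFields.YangMills.Theses.F4SubCurvatureDoor
import Summits.QuantumFields.YangMills.Theorems.F4SubCurvatureDoorSubCurvatureClauseDensityTransfer
import HarnessLib

/-!
# Route `F4SubCurvatureDoor`, crux `SubCurvatureClause` ⟨stmt-QuantumFields-23763⟩ — LATTICE TRANSFER of the sub-curvature clause

Helper file (`--supports stmt-QuantumFields-23763 --as helper`; free-hands seat `ym-line-frs-p2` g19, step T3 «soft passage to the
limit kernel» of the director's TRANSFER brief R525a-ym / planner pre-brief `HOME g23/PREBRIEF-23763-transfer.md`).  Definition-free,
0 sorry, standard axioms.  No item is closed; no summit, no crux and no mass gap is proved by this file.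

WHAT.  `SubCurvatureClause` (route file `Theses/F4SubCurvatureDoor.lean` :374) asks, for every off-diagonal leg-scheme limit point `S₁`
and EVERY kernel `K` continuous off `0` representing `S₁ 2` on compactly supported off-diagonal test functions, that `‖x‖⁸ K(x) → 0` at
`x → 0` (asymptotic freedom of the continuum two-point function of the `a⁻⁴`-renormalised action density).  This file moves the whole
content to the LATTICE side, kernel-generically, over the tools of ✓`…SubCurvatureClauseDensityTransfer`:

* `tendsto_of_latticeCollarAF` (§3, ★): the LATTICE SUB-CURVATURE COLLAR in ε-form — for every `ε > 0` there are `β_ε` and a collar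
  scale `ℓ_ε > 0` such that for `β ≥ β_ε`, every torus `4R + 8 ≤ L`, `1 ≤ R`, `R·a(β) ≤ ℓ_ε` and every two sites at torus
  sup-distance `≥ 2R + 4`, `|E[(dens_x − E dens_x)(dens_y − E dens_y)]| ≤ (ε/R⁴)²` — implies the conclusion of `SubCurvatureClause`
  for every leg scheme in the units `a`, every limit point and every continuous representing kernel (`‖x‖⁸|K x| ≤ 74⁸ ε²` near `0`);
* `latticeCollarAF_of_weighted` / `tendsto_of_weightedCollar` (§4): the coupling-weighted shape of the pre-brief
  (`|E[…]| ≤ (C·c(R·a(β))/R⁴)²` with a modulating function `c → 0` at `0⁺`, e.g. a running coupling at the physical collar scale)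
  implies the ε-form, hence the clause's conclusion;
* `abs_torusE_dens_prod_le_of_plane` / `latticeCollarAF_of_planeCollarAF` (§4b): the PLANE-RESOLVED shape (the `n = 2` letter of
  `MomentBounds6` with constant `ε`, single-plane plaquette fields) implies the density shape (`dens = Σ_{i<j} plane (i,j)`, 36 terms);
* `subCurvatureClause_of_latticeCollarAF` / `subCurvatureClause_of_planeCollarAF` (§5, BY NAME): if every `(G, r, a)` of the clause's
  range carries the lattice sub-curvature collar (density / plane-resolved letter), then `Theses.F4SubCurvatureDoor.SubCurvatureClause`.

So ⟨23763⟩ is reduced, kernel-checked, to ONE finite-volume, two-plaquette statement on the lattice side (the pre-brief's «first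
non-transferring step» T2: correlator domination by a quantity vanishing with the physical collar scale — Bałaban-class, OPEN; the
literature proves UV stability of effective actions, not correlator asymptotics [cite: Balaban1989LargeFieldII]
[cite: MagnenRivasseauSeneor1993]).

HONEST LABEL: a transfer lemma; it proves NO asymptotic freedom; ⟨23763⟩, ⟨23036⟩ are open problems; the Yang–Mills mass gap is NOT
proved; no summit is proved by a line.
-/

set_option autoImplicit false

noncomputable section

open scoped SchwartzMap BigOperators
open MeasureTheory Filter Topology Metric Set
open Literature.MathematicalPhysics.QuantumFieldTheory Literature.MathematicalPhysics.QuantumLattice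
open Literature.MathematicalPhysics.AQFT
open Literature.Probability.LatticeModels (Site)
open Summit.QuantumFields.YangMills.Cruxes.OSLegsFromFemtoAndGap.DlrCollarTransfer (dens plane torusE MomentBounds6)
open Summit.QuantumFields.YangMills.Theorems.OSLegsFromFemtoAndGap
  (card_planes integrable_prod_plane_sub dens_sub_torusE_eq_sum)
open Summit.QuantumFields.YangMills.Cruxes.OSLegsAtWeakCouplingC.Sketch (Separated)
open Summit.QuantumFields.YangMills.Theorems.ROT (IsLegScheme OffDiagLimitAlong)
open Summit.QuantumFields.YangMills.Theorems.NPointIsotropy.Negative (E4)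
open Summit.QuantumFields.YangMills.Theorems.F4SubCurvatureDoorSubCurvatureClauseDensityTransfer
  (abs_le_of_density_bound norm_two_le_of_offDiagLimitAlong_of_collar)

namespace Summit.QuantumFields.YangMills.Theorems.F4SubCurvatureDoorSubCurvatureClauseLatticeTransfer

variable {G : Type} [Group G] [TopologicalSpace G] [IsTopologicalGroup G] [CompactSpace G]
  [MeasurableSpace G] [BorelSpace G]

/-! ## §3 ★ The lattice sub-curvature collar implies the sub-curvature clause -/

/-- ★ **LATTICE TRANSFER of the sub-curvature clause.**  Suppose the LATTICE SUB-CURVATURE COLLAR in the units `a`: for every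
`ε > 0` there are `β_ε` and a collar scale `ℓ_ε > 0` such that for all `β ≥ β_ε`, every torus of half-side `L` with `4R + 8 ≤ L`, every
`1 ≤ R` with `R·a(β) ≤ ℓ_ε`, and every two sites at torus sup-distance `≥ 2R + 4` in some coordinate, the centred two-point moment of
the action densities obeys `|E[(dens_x − E dens_x)(dens_y − E dens_y)]| ≤ (ε/R⁴)²`.  Then for every admissible leg scheme in the units
`a`, every subsequence `φ → ∞`, every off-diagonal limit point `S₁` and EVERY kernel `K` continuous off `0` representing `S₁ 2` on
compactly supported off-diagonal test functions, `‖x‖⁸ K(x) → 0` as `x → 0` — the conclusion of `SubCurvatureClause`.  Quantitatively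
`‖x‖⁸ |K x| ≤ 74⁸ ε²` for `0 < ‖x‖ ≤ min 1 ℓ_ε` (density bound at `δ = ‖x‖/2`, then §1). -/
theorem tendsto_of_latticeCollarAF (r : LatticeRep G) {a : ℝ → ℝ}
    (hAF : ∀ ε : ℝ, 0 < ε → ∃ βε ℓε : ℝ, 0 < ℓε ∧ ∀ β : ℝ, βε ≤ β →
      ∀ (L : ℕ) (x : Fin 2 → Site 4) (R : ℕ), 1 ≤ R → (R : ℝ) * a β ≤ ℓε → 4 * R + 8 ≤ L →
        (∀ i j : Fin 2, i ≠ j → ∃ k : Fin 4,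
          (2 * (R : ℤ) + 4) ≤ |((((x i k - x j k : ℤ) : ZMod (2 * L + 1))).valMinAbs : ℤ)|) →
        |torusE G r β L (fun U => ∏ i, (dens G r (x i) U - torusE G r β L (dens G r (x i))))| ≤ (ε / (R : ℝ) ^ 4) ^ 2)
    {sch : SpeciesScheme (YMSpecies G)} (hsch : IsLegScheme a sch) {φ : ℕ → ℕ} (hφ : Tendsto φ atTop atTop)
    {S₁ : SchwingerFamily E4} (hS₁ : OffDiagLimitAlong r sch φ S₁)
    (K : E4 → ℝ) (hKc : ContinuousOn K {x | x ≠ 0})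
    (hrep : ∀ F : 𝓢((Fin 2 → E4), ℂ), IsOffDiagonal F → HasCompactSupport (F : (Fin 2 → E4) → ℂ) →
      Integrable (fun x : Fin 2 → E4 => (K (x 0 - x 1) : ℂ) * F x) ∧
        S₁ 2 F = ∫ x : Fin 2 → E4, (K (x 0 - x 1) : ℂ) * F x) :
    Tendsto (fun x : E4 => ‖x‖ ^ 8 * K x) (𝓝[≠] 0) (𝓝 0) := by
  rw [Metric.tendsto_nhdsWithin_nhds]
  intro ε' hε'
  -- the lattice collar at `ε = min 1 (ε' / (2 · 74⁸))`
  set ε : ℝ := min 1 (ε' / (2 * 74 ^ 8)) with hεdef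
  have hε0 : 0 < ε := lt_min one_pos (by positivity)
  have hε1 : ε ≤ 1 := min_le_left _ _
  have hεε' : ε * (2 * 74 ^ 8) ≤ ε' := by
    have h : ε ≤ ε' / (2 * 74 ^ 8) := min_le_right _ _
    rwa [le_div_iff₀ (by positivity)] at h
  obtain ⟨βε, ℓε, hℓε, H⟩ := hAF ε hε0
  -- density bound for the limit point, pointwise bound for the kernel
  have hdens := norm_two_le_of_offDiagLimitAlong_of_collar r hℓε hε0.le H hsch hφ hS₁
  have hpt : ∀ δ : ℝ, 0 < δ → ∀ x : E4, δ < ‖x‖ → |K x| ≤ (ε * (24 / δ + 2 / ℓε + 24) ^ 4) ^ 2 :=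
    fun δ hδ => abs_le_of_density_bound K hKc (S₁ 2) hrep hδ (hdens δ hδ)
  refine ⟨min 1 ℓε, lt_min one_pos hℓε, fun x hx hxd => ?_⟩
  have hx0 : x ≠ 0 := hx
  have hnx : 0 < ‖x‖ := norm_pos_iff.2 hx0
  rw [dist_zero_right] at hxd
  have hx1 : ‖x‖ < 1 := hxd.trans_le (min_le_left _ _)
  have hxℓ : ‖x‖ < ℓε := hxd.trans_le (min_le_right _ _)
  -- at `δ = ‖x‖/2`: `κ ≤ 74/‖x‖`
  have hδ : 0 < ‖x‖ / 2 := by positivity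
  have hκ : 24 / (‖x‖ / 2) + 2 / ℓε + 24 ≤ 74 / ‖x‖ := by
    rw [div_div_eq_mul_div]
    have h1 : 2 / ℓε ≤ 2 / ‖x‖ := div_le_div_of_nonneg_left (by norm_num) hnx hxℓ.le
    have h2 : (24 : ℝ) ≤ 24 / ‖x‖ := by
      rw [le_div_iff₀ hnx]
      nlinarith
    have h3 : 24 * 2 / ‖x‖ + 2 / ‖x‖ + 24 / ‖x‖ = 74 / ‖x‖ := by ring
    linarith
  have hκ0 : 0 ≤ 24 / (‖x‖ / 2) + 2 / ℓε + 24 := by positivity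
  have hK := hpt (‖x‖ / 2) hδ x (by linarith)
  have hK' : |K x| ≤ ε ^ 2 * (74 / ‖x‖) ^ 8 := by
    calc |K x| ≤ (ε * (24 / (‖x‖ / 2) + 2 / ℓε + 24) ^ 4) ^ 2 := hK
      _ ≤ (ε * (74 / ‖x‖) ^ 4) ^ 2 := by
          have h := pow_le_pow_left₀ hκ0 hκ 4
          exact pow_le_pow_left₀ (by positivity) (mul_le_mul_of_nonneg_left h hε0.le) 2
      _ = ε ^ 2 * (74 / ‖x‖) ^ 8 := by ring
  -- `‖x‖⁸ |K x| ≤ 74⁸ ε² < ε'`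
  rw [Real.dist_eq, sub_zero, abs_mul, abs_of_nonneg (by positivity : (0 : ℝ) ≤ ‖x‖ ^ 8)]
  have h8 : ‖x‖ ^ 8 * (74 / ‖x‖) ^ 8 = 74 ^ 8 := by
    rw [div_pow, mul_div_assoc', mul_comm, mul_div_assoc, div_self (pow_ne_zero 8 hnx.ne'), mul_one]
  calc ‖x‖ ^ 8 * |K x| ≤ ‖x‖ ^ 8 * (ε ^ 2 * (74 / ‖x‖) ^ 8) := mul_le_mul_of_nonneg_left hK' (by positivity)
    _ = ε ^ 2 * 74 ^ 8 := by rw [mul_left_comm, h8, mul_comm]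
    _ ≤ ε * 74 ^ 8 := by
        rw [sq]
        exact mul_le_mul_of_nonneg_right (mul_le_of_le_one_left hε0.le hε1) (by positivity)
    _ < ε' := by nlinarith

/-! ## §4 The coupling-weighted shape implies the ε-form -/

/-- **Coupling-weighted two-point collar ⇒ lattice sub-curvature collar.**  If the centred two-point moment of the action densities
obeys `|E[(dens_x − E)(dens_y − E)]| ≤ (C · c(R·a(β)) / R⁴)²` in the collar regime (`β ≥ β₄`, `1 ≤ R`, `R·a(β) ≤ ℓ₄`, `4R+8 ≤ L`, torus
sup-separation `≥ 2R+4`) with a modulating function `c` of the PHYSICAL collar scale tending to `0` at `0⁺` (the pre-brief's T1 ∧ T2: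
`c` = a running coupling at scale `R·a`), and the units are positive, then the ε-form of §3 holds. -/
theorem latticeCollarAF_of_weighted (r : LatticeRep G) {a : ℝ → ℝ} (hapos : ∀ β, 0 < a β)
    {C β₄ ℓ₄ : ℝ} {c : ℝ → ℝ} (hℓ : 0 < ℓ₄) (hC : 0 ≤ C) (hc : Tendsto c (𝓝[>] 0) (𝓝 0))
    (H : ∀ β : ℝ, β₄ ≤ β → ∀ (L : ℕ) (x : Fin 2 → Site 4) (R : ℕ), 1 ≤ R → (R : ℝ) * a β ≤ ℓ₄ → 4 * R + 8 ≤ L →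
      (∀ i j : Fin 2, i ≠ j → ∃ k : Fin 4,
        (2 * (R : ℤ) + 4) ≤ |((((x i k - x j k : ℤ) : ZMod (2 * L + 1))).valMinAbs : ℤ)|) →
      |torusE G r β L (fun U => ∏ i, (dens G r (x i) U - torusE G r β L (dens G r (x i))))| ≤
        (C * c ((R : ℝ) * a β) / (R : ℝ) ^ 4) ^ 2) :
    ∀ ε : ℝ, 0 < ε → ∃ βε ℓε : ℝ, 0 < ℓε ∧ ∀ β : ℝ, βε ≤ β →
      ∀ (L : ℕ) (x : Fin 2 → Site 4) (R : ℕ), 1 ≤ R → (R : ℝ) * a β ≤ ℓε → 4 * R + 8 ≤ L →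
        (∀ i j : Fin 2, i ≠ j → ∃ k : Fin 4,
          (2 * (R : ℤ) + 4) ≤ |((((x i k - x j k : ℤ) : ZMod (2 * L + 1))).valMinAbs : ℤ)|) →
        |torusE G r β L (fun U => ∏ i, (dens G r (x i) U - torusE G r β L (dens G r (x i))))| ≤ (ε / (R : ℝ) ^ 4) ^ 2 := by
  intro ε hε
  -- `|c ℓ| < ε / (C + 1)` for `0 < ℓ < d`
  obtain ⟨d, hd, hcd⟩ := (Metric.tendsto_nhdsWithin_nhds.1 hc) (ε / (C + 1)) (by positivity)
  refine ⟨β₄, min ℓ₄ (d / 2), lt_min hℓ (by positivity), fun β hβ L x R hR1 hRℓ hRL hsep => ?_⟩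
  have hRℓ₄ : (R : ℝ) * a β ≤ ℓ₄ := hRℓ.trans (min_le_left _ _)
  have hRpos : (0 : ℝ) < R := by exact_mod_cast hR1
  have hℓpos : 0 < (R : ℝ) * a β := mul_pos hRpos (hapos β)
  have hℓd : dist ((R : ℝ) * a β) 0 < d := by
    rw [dist_zero_right, Real.norm_eq_abs, abs_of_pos hℓpos]
    exact (hRℓ.trans (min_le_right _ _)).trans_lt (by linarith)
  have hcε : |c ((R : ℝ) * a β)| < ε / (C + 1) := by
    have h := hcd (show (R : ℝ) * a β ∈ Ioi (0 : ℝ) from hℓpos) hℓd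
    rwa [Real.dist_eq, sub_zero] at h
  have hCc : |C * c ((R : ℝ) * a β)| ≤ ε := by
    rw [abs_mul, abs_of_nonneg hC]
    calc C * |c ((R : ℝ) * a β)| ≤ C * (ε / (C + 1)) := mul_le_mul_of_nonneg_left hcε.le hC
      _ = C / (C + 1) * ε := by ring
      _ ≤ 1 * ε := mul_le_mul_of_nonneg_right ((div_le_one (by positivity)).2 (by linarith)) hε.le
      _ = ε := one_mul ε
  refine (H β hβ L x R hR1 hRℓ₄ hRL hsep).trans ?_
  rw [div_pow, div_pow]
  refine div_le_div_of_nonneg_right ?_ (by positivity)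
  calc (C * c ((R : ℝ) * a β)) ^ 2 = |C * c ((R : ℝ) * a β)| ^ 2 := (sq_abs _).symm
    _ ≤ ε ^ 2 := pow_le_pow_left₀ (abs_nonneg _) hCc 2

/-- **Coupling-weighted two-point collar ⇒ the conclusion of `SubCurvatureClause`** (§4 ∘ §3): the pre-brief's T1 ∧ T2 shape
`|E[(dens_x − E)(dens_y − E)]| ≤ (C·c(R·a(β))/R⁴)²`, `c → 0` at `0⁺`, positive units, gives `‖x‖⁸ K(x) → 0` for every leg-scheme limit
point and every continuous representing kernel. -/
theorem tendsto_of_weightedCollar (r : LatticeRep G) {a : ℝ → ℝ} (hapos : ∀ β, 0 < a β)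
    {C β₄ ℓ₄ : ℝ} {c : ℝ → ℝ} (hℓ : 0 < ℓ₄) (hC : 0 ≤ C) (hc : Tendsto c (𝓝[>] 0) (𝓝 0))
    (H : ∀ β : ℝ, β₄ ≤ β → ∀ (L : ℕ) (x : Fin 2 → Site 4) (R : ℕ), 1 ≤ R → (R : ℝ) * a β ≤ ℓ₄ → 4 * R + 8 ≤ L →
      (∀ i j : Fin 2, i ≠ j → ∃ k : Fin 4,
        (2 * (R : ℤ) + 4) ≤ |((((x i k - x j k : ℤ) : ZMod (2 * L + 1))).valMinAbs : ℤ)|) →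
      |torusE G r β L (fun U => ∏ i, (dens G r (x i) U - torusE G r β L (dens G r (x i))))| ≤
        (C * c ((R : ℝ) * a β) / (R : ℝ) ^ 4) ^ 2)
    {sch : SpeciesScheme (YMSpecies G)} (hsch : IsLegScheme a sch) {φ : ℕ → ℕ} (hφ : Tendsto φ atTop atTop)
    {S₁ : SchwingerFamily E4} (hS₁ : OffDiagLimitAlong r sch φ S₁)
    (K : E4 → ℝ) (hKc : ContinuousOn K {x | x ≠ 0})
    (hrep : ∀ F : 𝓢((Fin 2 → E4), ℂ), IsOffDiagonal F → HasCompactSupport (F : (Fin 2 → E4) → ℂ) →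
      Integrable (fun x : Fin 2 → E4 => (K (x 0 - x 1) : ℂ) * F x) ∧
        S₁ 2 F = ∫ x : Fin 2 → E4, (K (x 0 - x 1) : ℂ) * F x) :
    Tendsto (fun x : E4 => ‖x‖ ^ 8 * K x) (𝓝[≠] 0) (𝓝 0) :=
  tendsto_of_latticeCollarAF r (latticeCollarAF_of_weighted r hapos hℓ hC hc H) hsch hφ hS₁ K hKc hrep

/-! ## §4b The plane-resolved (`MomentBounds6`-letter) shape implies the density shape -/

/-- **Plane expansion at a fixed order**: if every string of centred single-plane fields at the sites `x` has torus moment `≤ B` in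
absolute value, the centred moment of the action densities at `x` is `≤ 6ⁿ B` (`dens = Σ_{i<j} plane (i, j)`; the proof of
✓`momentBounds_of_momentBounds6` with the order fixed). -/
theorem abs_torusE_dens_prod_le_of_plane (r : LatticeRep G) (β : ℝ) (L : ℕ) {n : ℕ} (x : Fin n → Site 4) {B : ℝ}
    (hB : ∀ q : Fin n → Fin 4 × Fin 4, (∀ i, (q i).1 < (q i).2) →
      |torusE G r β L (fun U => ∏ i, (plane G r (q i) (x i) U - torusE G r β L (plane G r (q i) (x i))))| ≤ B) :
    |torusE G r β L (fun U => ∏ i, (dens G r (x i) U - torusE G r β L (dens G r (x i))))| ≤ 6 ^ n * B := by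
  classical
  -- adapted from ✓`OSLegsFromFemtoAndGap.momentBounds_of_momentBounds6`
  set P : Finset (Fin 4 × Fin 4) := Finset.univ.filter (fun q : Fin 4 × Fin 4 => q.1 < q.2) with hP
  have hexp : ∀ U : GaugeConfig 4 (2 * L + 1) G,
      ∏ i, (dens G r (x i) (torusLift (2 * L + 1) U) - torusE G r β L (dens G r (x i))) =
        ∑ q ∈ Fintype.piFinset (fun _ : Fin n => P),
          ∏ i, (plane G r (q i) (x i) (torusLift (2 * L + 1) U) - torusE G r β L (plane G r (q i) (x i))) := by
    intro U
    simp_rw [dens_sub_torusE_eq_sum r β L]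
    rw [Finset.prod_univ_sum]
  have hint : torusE G r β L (fun V => ∏ i, (dens G r (x i) V - torusE G r β L (dens G r (x i)))) =
      ∑ q ∈ Fintype.piFinset (fun _ : Fin n => P),
        torusE G r β L (fun V => ∏ i, (plane G r (q i) (x i) V - torusE G r β L (plane G r (q i) (x i)))) := by
    unfold torusE
    rw [← integral_finsetSum _ (fun q _ => integrable_prod_plane_sub r β L q x _)]
    exact integral_congr_ae (Eventually.of_forall fun U => hexp U)
  rw [hint]
  have hterm : ∀ q ∈ Fintype.piFinset (fun _ : Fin n => P),
      |torusE G r β L (fun V => ∏ i, (plane G r (q i) (x i) V - torusE G r β L (plane G r (q i) (x i))))| ≤ B := by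
    intro q hq
    refine hB q fun i => ?_
    have := Fintype.mem_piFinset.1 hq i
    rw [hP, Finset.mem_filter] at this
    exact this.2
  calc |∑ q ∈ Fintype.piFinset (fun _ : Fin n => P),
        torusE G r β L (fun V => ∏ i, (plane G r (q i) (x i) V - torusE G r β L (plane G r (q i) (x i))))|
      ≤ ∑ q ∈ Fintype.piFinset (fun _ : Fin n => P),
        |torusE G r β L (fun V => ∏ i, (plane G r (q i) (x i) V - torusE G r β L (plane G r (q i) (x i))))| :=
        Finset.abs_sum_le_sum_abs _ _
    _ ≤ ∑ _q ∈ Fintype.piFinset (fun _ : Fin n => P), B := Finset.sum_le_sum hterm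
    _ = 6 ^ n * B := by
        rw [Finset.sum_const, nsmul_eq_mul, Fintype.card_piFinset, Finset.prod_const, Finset.card_univ,
          Fintype.card_fin, hP, card_planes]
        push_cast
        ring

/-- **Plane-resolved lattice sub-curvature collar ⇒ density form.**  The ε-form collar stated for strings of two SINGLE-PLANE plaquette
fields (the `n = 2` letter of `MomentBounds6` with constant `ε`: orientations `q i = (i₁ < i₂)`) implies the ε-form collar of §3 for the
action densities (`ε ↦ 6ε` absorbed). -/
theorem latticeCollarAF_of_planeCollarAF (r : LatticeRep G) {a : ℝ → ℝ}
    (hAF6 : ∀ ε : ℝ, 0 < ε → ∃ βε ℓε : ℝ, 0 < ℓε ∧ ∀ β : ℝ, βε ≤ β →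
      ∀ (L : ℕ) (q : Fin 2 → Fin 4 × Fin 4) (x : Fin 2 → Site 4) (R : ℕ), (∀ i, (q i).1 < (q i).2) →
        1 ≤ R → (R : ℝ) * a β ≤ ℓε → 4 * R + 8 ≤ L →
        (∀ i j : Fin 2, i ≠ j → ∃ k : Fin 4,
          (2 * (R : ℤ) + 4) ≤ |((((x i k - x j k : ℤ) : ZMod (2 * L + 1))).valMinAbs : ℤ)|) →
        |torusE G r β L (fun U => ∏ i, (plane G r (q i) (x i) U - torusE G r β L (plane G r (q i) (x i))))| ≤
          (ε / (R : ℝ) ^ 4) ^ 2) :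
    ∀ ε : ℝ, 0 < ε → ∃ βε ℓε : ℝ, 0 < ℓε ∧ ∀ β : ℝ, βε ≤ β →
      ∀ (L : ℕ) (x : Fin 2 → Site 4) (R : ℕ), 1 ≤ R → (R : ℝ) * a β ≤ ℓε → 4 * R + 8 ≤ L →
        (∀ i j : Fin 2, i ≠ j → ∃ k : Fin 4,
          (2 * (R : ℤ) + 4) ≤ |((((x i k - x j k : ℤ) : ZMod (2 * L + 1))).valMinAbs : ℤ)|) →
        |torusE G r β L (fun U => ∏ i, (dens G r (x i) U - torusE G r β L (dens G r (x i))))| ≤ (ε / (R : ℝ) ^ 4) ^ 2 := by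
  intro ε hε
  obtain ⟨βε, ℓε, hℓε, H⟩ := hAF6 (ε / 6) (by positivity)
  refine ⟨βε, ℓε, hℓε, fun β hβ L x R hR1 hRℓ hRL hsep => ?_⟩
  refine (abs_torusE_dens_prod_le_of_plane r β L x fun q hq => H β hβ L q x R hq hR1 hRℓ hRL hsep).trans (le_of_eq ?_)
  ring

/-! ## §5 `SubCurvatureClause` BY NAME from the lattice sub-curvature collar -/

/-- ★ **`SubCurvatureClause` from the LATTICE SUB-CURVATURE COLLAR, by name.**  If for every compact simple `G`, every lattice
representation `r` and every positive unit map `a → 0` carrying `MomentBounds6` the lattice sub-curvature collar of §3 holds (ε-form: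
two-point centred-density moments `≤ (ε/R⁴)²` at collar scales `R·a(β) ≤ ℓ_ε`, `β ≥ β_ε`), then
`Theses.F4SubCurvatureDoor.SubCurvatureClause` ⟨stmt-QuantumFields-23763⟩.  The hypothesis is the lattice-side home of asymptotic
freedom of the two-point function of the action density (Bałaban-class, OPEN); nothing here proves it. -/
theorem subCurvatureClause_of_latticeCollarAF
    (hAF : ∀ (G : Type) [Group G] [TopologicalSpace G] [IsTopologicalGroup G] [CompactSpace G],
      IsCompactSimpleLieGroup G → letI : MeasurableSpace G := borel G; haveI : BorelSpace G := ⟨rfl⟩;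
      ∀ (r : LatticeRep G) (a : ℝ → ℝ), (∀ β, 0 < a β) → Tendsto a atTop (𝓝 0) → MomentBounds6 G r a →
        ∀ ε : ℝ, 0 < ε → ∃ βε ℓε : ℝ, 0 < ℓε ∧ ∀ β : ℝ, βε ≤ β →
          ∀ (L : ℕ) (x : Fin 2 → Site 4) (R : ℕ), 1 ≤ R → (R : ℝ) * a β ≤ ℓε → 4 * R + 8 ≤ L →
            (∀ i j : Fin 2, i ≠ j → ∃ k : Fin 4,
              (2 * (R : ℤ) + 4) ≤ |((((x i k - x j k : ℤ) : ZMod (2 * L + 1))).valMinAbs : ℤ)|) →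
            |torusE G r β L (fun U => ∏ i, (dens G r (x i) U - torusE G r β L (dens G r (x i))))| ≤
              (ε / (R : ℝ) ^ 4) ^ 2) :
    Summit.QuantumFields.YangMills.Theses.F4SubCurvatureDoor.SubCurvatureClause := by
  intro G _ _ _ _ hG
  letI : MeasurableSpace G := borel G
  haveI : BorelSpace G := ⟨rfl⟩
  intro r a hapos ha0 hMB sch hsch φ hφ S₁ hS₁ K hKc hrep
  exact tendsto_of_latticeCollarAF r (hAF G hG r a hapos ha0 hMB) hsch hφ hS₁ K hKc hrep

/-- ★ **`SubCurvatureClause` from the PLANE-RESOLVED lattice sub-curvature collar, by name** (the `n = 2` letter of `MomentBounds6`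
with constant `ε` at collar scales `R·a(β) ≤ ℓ_ε`, for every `(G, r, a)` of the clause's range) — §4b ∘ §5. -/
theorem subCurvatureClause_of_planeCollarAF
    (hAF6 : ∀ (G : Type) [Group G] [TopologicalSpace G] [IsTopologicalGroup G] [CompactSpace G],
      IsCompactSimpleLieGroup G → letI : MeasurableSpace G := borel G; haveI : BorelSpace G := ⟨rfl⟩;
      ∀ (r : LatticeRep G) (a : ℝ → ℝ), (∀ β, 0 < a β) → Tendsto a atTop (𝓝 0) → MomentBounds6 G r a →
        ∀ ε : ℝ, 0 < ε → ∃ βε ℓε : ℝ, 0 < ℓε ∧ ∀ β : ℝ, βε ≤ β →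
          ∀ (L : ℕ) (q : Fin 2 → Fin 4 × Fin 4) (x : Fin 2 → Site 4) (R : ℕ), (∀ i, (q i).1 < (q i).2) →
            1 ≤ R → (R : ℝ) * a β ≤ ℓε → 4 * R + 8 ≤ L →
            (∀ i j : Fin 2, i ≠ j → ∃ k : Fin 4,
              (2 * (R : ℤ) + 4) ≤ |((((x i k - x j k : ℤ) : ZMod (2 * L + 1))).valMinAbs : ℤ)|) →
            |torusE G r β L (fun U => ∏ i, (plane G r (q i) (x i) U - torusE G r β L (plane G r (q i) (x i))))| ≤
              (ε / (R : ℝ) ^ 4) ^ 2) :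
    Summit.QuantumFields.YangMills.Theses.F4SubCurvatureDoor.SubCurvatureClause := by
  refine subCurvatureClause_of_latticeCollarAF fun G _ _ _ _ hG => ?_
  letI : MeasurableSpace G := borel G
  haveI : BorelSpace G := ⟨rfl⟩
  intro r a hapos ha0 hMB
  exact latticeCollarAF_of_planeCollarAF r (hAF6 G hG r a hapos ha0 hMB)

end Summit.QuantumFields.YangMills.Theorems.F4SubCurvatureDoorSubCurvatureClauseLatticeTransfer

end
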